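import Summits.HodgeConjecture.HodgeConjecture.Theorems.HodgeLocusCensusPlaneRank
import Summits.HodgeConjecture.HodgeConjecture.Theorems.HodgeLocusCensusFourPlanesRank
import HarnessLib

/-!
# HodgeLocusCensusZprimeRank4 — PROVED: the census row `rankZprime_4_4` (rank 11 for Z′ = σ[Z] = Π(3,0)+Π(3,2)+Π(2,0)+Π(2,2) (+ tails), the TWISTED four-plane presentation on the Fermat quartic 4-fold) (cell pub-hlocus, LEAD gen 4, (T34/4))
HONEST FRAMING: certified instances and evidence bearing on the general Hodge conjecture; no claim.

`rankZprime_4_4 : IvhsRankEq 4 4 11 twistedFourPlanes4` (HodgeLocusCensusTwistCells) is the rank row of the second summand of open row r1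
(δ± = [Z] ± [Z′]); the census explains it as rank M_Z′ = rank M_Z (11) because σ is an automorphism of X_F. Proved here DIRECTLY, by the
mode mechanism of the `FourPlanesRank*` files: the slot-0 characters of Z′ are (7 | 5) instead of Z's (1 | 7), slot 1 is (1 | 5) as for Z, so for a
primitive 8th root the entry collapses (`entry_eq_S`) to 2(1 + ζ^{2(i₀+j₀+1)})ζ^{e + 4(i₀+j₀+1)} on the SAME support as for Z ({all pair sums 2, i₀+j₀ even,
i₂+j₂ = 1}); the scalar 1 + ζ^{2(i₀+j₀+1)} ∈ {1 + ζ², 1 + ζ⁶} is non-zero and depends on the row only (types with σ₀ = 2) or on the column and the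
mode only (σ₀ ≤ 1), so every mode block is still rank one: M_[Z′] = U · V through K^11 (`ivhsMatrix_zprime_eq_mul`, rank ≤ 11) and the symbolic
diagonal 11 × 11 witness minor of the Z files has non-zero diagonal here too (rank ≥ 11). The (type, parity) mode tables `modeK/modeP0/modeP2` and `mode_inj` are REUSED from `HodgeLocusCensusFourPlanesRank` (namespace `FourPlanes`); the witness picks are this file's. Numerics of record: engines A = B: 11.
-/

namespace Summit.HodgeConjecture.HodgeConjecture.HodgeLocus.Census.Zprime4
open TwistCells GrSection PlaneRank

/-- the (4,4) pair-sum types have coordinates ≤ 2 … -/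
theorem sig_le4 : ∀ k : Fin 6, sig0 k ≤ 2 ∧ sig1 k ≤ 2 ∧ sig2 k ≤ 2 := by decide

/-- … total 2 … -/
theorem sig_sum4 : ∀ k : Fin 6, sig0 k + sig1 k + sig2 k = 2 := by decide

set_option synthInstance.maxSize 1024 in
set_option synthInstance.maxHeartbeats 400000 in
/-- … and every such triple is a type. -/
theorem sig_cover4 : ∀ s0 < 3, ∀ s1 < 3, ∀ s2 < 3, s0 + s1 + s2 = 2 → ∃ k : Fin 6, s0 = sig0 k ∧ s1 = sig1 k ∧ s2 = sig2 k := by decide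

/-- closed form of an entry of M_[Z′] for an arbitrary ζ: the four plane terms. -/
theorem entry_eq {K : Type*} [Field K] (ζ : K) (i : Fin 6 → ℕ) (hi : i ∈ indexSet 4 4 (4 / 2 * 4 - 4 - 2))
    (j : Fin 6 → ℕ) (hj : j ∈ indexSet 4 4 4) :
    ivhsMatrix 4 4 ζ [(1, plane44 3 0 0), (1, plane44 3 2 0), (1, plane44 2 0 0), (1, plane44 2 2 0)] ⟨i, hi⟩ ⟨j, hj⟩ =
      if i 0 + j 0 + (i 1 + j 1) = 2 ∧ i 2 + j 2 + (i 3 + j 3) = 2 ∧ i 4 + j 4 + (i 5 + j 5) = 2 then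
        ζ ^ ((i 0 + j 0 + 1) * (1 + 2 * 3) + (i 2 + j 2 + 1) * (1 + 2 * 0) + (i 4 + j 4 + 1) * (1 + 2 * 0)) +
          (ζ ^ ((i 0 + j 0 + 1) * (1 + 2 * 3) + (i 2 + j 2 + 1) * (1 + 2 * 2) + (i 4 + j 4 + 1) * (1 + 2 * 0)) +
            (ζ ^ ((i 0 + j 0 + 1) * (1 + 2 * 2) + (i 2 + j 2 + 1) * (1 + 2 * 0) + (i 4 + j 4 + 1) * (1 + 2 * 0)) +
              ζ ^ ((i 0 + j 0 + 1) * (1 + 2 * 2) + (i 2 + j 2 + 1) * (1 + 2 * 2) + (i 4 + j 4 + 1) * (1 + 2 * 0)))) else 0 := by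
  unfold ivhsMatrix periodComb
  simp only [List.map, List.sum_cons, List.sum_nil, Rat.cast_one, one_mul, add_zero, period_plane44]
  split_ifs <;> simp

/-- COLLAPSE for a primitive 8th root: an entry is 2(1 + ζ^{2(i₀+j₀+1)})ζ^{e + 4(i₀+j₀+1)} when all pair sums of i + j are 2, i₀ + j₀ is even and i₂ + j₂ = 1, else 0. -/
theorem entry_eq_S {K : Type*} [Field K] (ζ : K) (h4 : ζ ^ 4 = -1) (i : Fin 6 → ℕ) (hi : i ∈ indexSet 4 4 (4 / 2 * 4 - 4 - 2))
    (j : Fin 6 → ℕ) (hj : j ∈ indexSet 4 4 4) :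
    ivhsMatrix 4 4 ζ [(1, plane44 3 0 0), (1, plane44 3 2 0), (1, plane44 2 0 0), (1, plane44 2 2 0)] ⟨i, hi⟩ ⟨j, hj⟩ =
      if (i 0 + j 0 + (i 1 + j 1) = 2 ∧ i 2 + j 2 + (i 3 + j 3) = 2 ∧ i 4 + j 4 + (i 5 + j 5) = 2) ∧
          (i 0 + j 0) % 2 = 0 ∧ i 2 + j 2 = 1 then
        2 * (1 + ζ ^ (2 * (i 0 + j 0 + 1))) * ζ ^ ((i 0 + j 0 + 1) * (1 + 2 * 0) + (i 2 + j 2 + 1) * (1 + 2 * 0) + (i 4 + j 4 + 1) * (1 + 2 * 0) + 4 * (i 0 + j 0 + 1))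
      else 0 := by
  have collapse2 : ∀ e A B : ℕ,
      ζ ^ (e + 6 * A) + (ζ ^ (e + (6 * A + 4 * B)) + (ζ ^ (e + 4 * A) + ζ ^ (e + (4 * A + 4 * B)))) =
        ζ ^ (e + 4 * A) * ((1 + ζ ^ (2 * A)) * (1 + ζ ^ (4 * B))) := by
    intro e A B
    simp only [pow_add]
    ring
  have scalar_cases : ∀ A B : ℕ, A ≤ 2 → B ≤ 2 →
      (1 + ζ ^ (2 * (A + 1))) * (1 + ζ ^ (4 * (B + 1))) = if A % 2 = 0 ∧ B = 1 then 2 * (1 + ζ ^ (2 * (A + 1))) else 0 := by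
    intro A B hA hB
    have h8 : ζ ^ 8 = 1 := by linear_combination (ζ ^ 4 - 1) * h4
    have h12 : ζ ^ 12 = -1 := by linear_combination (ζ ^ 8 - ζ ^ 4 + 1) * h4
    interval_cases A <;> interval_cases B
    · norm_num [h4, h8, h12]
    · norm_num [h4, h8, h12]
      ring
    · norm_num [h4, h8, h12]
    · norm_num [h4, h8, h12]
    · norm_num [h4, h8, h12]
    · norm_num [h4, h8, h12]
    · norm_num [h4, h8, h12]
    · norm_num [h4, h8, h12]
      ring
    · norm_num [h4, h8, h12]
  rw [entry_eq]
  by_cases hc : i 0 + j 0 + (i 1 + j 1) = 2 ∧ i 2 + j 2 + (i 3 + j 3) = 2 ∧ i 4 + j 4 + (i 5 + j 5) = 2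
  · rw [if_pos hc]
    have e30 : (i 0 + j 0 + 1) * (1 + 2 * 3) + (i 2 + j 2 + 1) * (1 + 2 * 0) + (i 4 + j 4 + 1) * (1 + 2 * 0) =
        (i 0 + j 0 + 1) * (1 + 2 * 0) + (i 2 + j 2 + 1) * (1 + 2 * 0) + (i 4 + j 4 + 1) * (1 + 2 * 0) + 6 * (i 0 + j 0 + 1) := by ring
    have e32 : (i 0 + j 0 + 1) * (1 + 2 * 3) + (i 2 + j 2 + 1) * (1 + 2 * 2) + (i 4 + j 4 + 1) * (1 + 2 * 0) =
        (i 0 + j 0 + 1) * (1 + 2 * 0) + (i 2 + j 2 + 1) * (1 + 2 * 0) + (i 4 + j 4 + 1) * (1 + 2 * 0) +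
          (6 * (i 0 + j 0 + 1) + 4 * (i 2 + j 2 + 1)) := by ring
    have e20 : (i 0 + j 0 + 1) * (1 + 2 * 2) + (i 2 + j 2 + 1) * (1 + 2 * 0) + (i 4 + j 4 + 1) * (1 + 2 * 0) =
        (i 0 + j 0 + 1) * (1 + 2 * 0) + (i 2 + j 2 + 1) * (1 + 2 * 0) + (i 4 + j 4 + 1) * (1 + 2 * 0) + 4 * (i 0 + j 0 + 1) := by ring
    have e22 : (i 0 + j 0 + 1) * (1 + 2 * 2) + (i 2 + j 2 + 1) * (1 + 2 * 2) + (i 4 + j 4 + 1) * (1 + 2 * 0) =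
        (i 0 + j 0 + 1) * (1 + 2 * 0) + (i 2 + j 2 + 1) * (1 + 2 * 0) + (i 4 + j 4 + 1) * (1 + 2 * 0) +
          (4 * (i 0 + j 0 + 1) + 4 * (i 2 + j 2 + 1)) := by ring
    rw [e30, e32, e20, e22, collapse2, scalar_cases (i 0 + j 0) (i 2 + j 2) (by omega) (by omega)]
    by_cases hs : (i 0 + j 0) % 2 = 0 ∧ i 2 + j 2 = 1
    · rw [if_pos hs, if_pos ⟨hc, hs⟩]
      ring
    · rw [if_neg hs, if_neg (fun h => hs h.2), mul_zero]
  · rw [if_neg hc, if_neg (fun h => hc h.1)]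

/-- subtype-indexed form of `entry_eq_S`. -/
theorem entry_eq_S' {K : Type*} [Field K] (ζ : K) (h4 : ζ ^ 4 = -1) (i : indexSet 4 4 (4 / 2 * 4 - 4 - 2)) (j : indexSet 4 4 4) :
    ivhsMatrix 4 4 ζ [(1, plane44 3 0 0), (1, plane44 3 2 0), (1, plane44 2 0 0), (1, plane44 2 2 0)] i j =
      if (i.1 0 + j.1 0 + (i.1 1 + j.1 1) = 2 ∧ i.1 2 + j.1 2 + (i.1 3 + j.1 3) = 2 ∧ i.1 4 + j.1 4 + (i.1 5 + j.1 5) = 2) ∧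
          (i.1 0 + j.1 0) % 2 = 0 ∧ i.1 2 + j.1 2 = 1 then
        2 * (1 + ζ ^ (2 * (i.1 0 + j.1 0 + 1))) * ζ ^ ((i.1 0 + j.1 0 + 1) * (1 + 2 * 0) + (i.1 2 + j.1 2 + 1) * (1 + 2 * 0) + (i.1 4 + j.1 4 + 1) * (1 + 2 * 0) + 4 * (i.1 0 + j.1 0 + 1))
      else 0 :=
  entry_eq_S ζ h4 i.1 i.2 j.1 j.2

/-- liveness bookkeeping of the modes (used for the witness picks). -/
theorem mode_live : ∀ m : Fin 11, FourPlanes.modeP0 m ≤ 1 ∧ FourPlanes.modeP2 m ≤ 1 ∧ FourPlanes.modeP0 m ≤ sig0 (FourPlanes.modeK m) ∧ FourPlanes.modeP0 m + sig0 (FourPlanes.modeK m) ≤ 2 ∧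
    FourPlanes.modeP2 m ≤ sig1 (FourPlanes.modeK m) ∧ sig1 (FourPlanes.modeK m) ≤ 1 + FourPlanes.modeP2 m := by decide

set_option synthInstance.maxSize 1024 in
set_option synthInstance.maxHeartbeats 400000 in
/-- every LIVE (type, parity, parity) combination is a mode: p₀ odd forces σ₀ = 1; p₂ even forces σ₁ ≤ 1; p₂ odd forces σ₁ ≥ 1. -/
theorem mode_cover : ∀ (k : Fin 6), ∀ p0 < 2, ∀ p2 < 2, (p0 = 1 → sig0 k = 1) → (p2 = 0 → sig1 k ≤ 1) → (p2 = 1 → 1 ≤ sig1 k) →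
    ∃ m : Fin 11, FourPlanes.modeK m = k ∧ FourPlanes.modeP0 m = p0 ∧ FourPlanes.modeP2 m = p2 := by decide

/-- the total degree of a row index. -/
theorem row_deg (i : Fin 6 → ℕ) (hi : i ∈ indexSet 4 4 (4 / 2 * 4 - 4 - 2)) : i 0 + i 1 + i 2 + i 3 + i 4 + i 5 = 2 := by
  have h := (Finset.mem_filter.mp hi).2
  rw [Finset.sum_fin_eq_sum_range] at h
  simp [Finset.sum_range_succ] at h
  omega

/-- left factor U (rows × 11): 2ζ^{5i₀ + i₂ + …} on the rows of the mode, times the scalar 1 + ζ^{2(i₀+1)} when σ₀ = 2 (then j₀ = 0). -/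
noncomputable def factorU {K : Type*} [Field K] (ζ : K) : Matrix (indexSet 4 4 (4 / 2 * 4 - 4 - 2)) (Fin 11) K :=
  fun i m => if (i.1 0 + i.1 1 = sig0 (FourPlanes.modeK m) ∧ i.1 2 + i.1 3 = sig1 (FourPlanes.modeK m) ∧ i.1 4 + i.1 5 = sig2 (FourPlanes.modeK m)) ∧
      i.1 0 % 2 = FourPlanes.modeP0 m ∧ i.1 2 % 2 = FourPlanes.modeP2 m then
    2 * ζ ^ (5 * i.1 0 + i.1 2 + i.1 4) * (if sig0 (FourPlanes.modeK m) = 2 then 1 + ζ ^ (2 * (i.1 0 + 1)) else 1) else 0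

/-- right factor V (11 × columns): ζ^{5j₀ + 5 + (j₂+1) + …} on the columns of complementary type and the right parities, times the scalar
1 + ζ^{2(p₀+j₀+1)} when σ₀ ≤ 1 (then i₀ = p₀). -/
noncomputable def factorV {K : Type*} [Field K] (ζ : K) : Matrix (Fin 11) (indexSet 4 4 4) K :=
  fun m j => if (sig0 (FourPlanes.modeK m) + (j.1 0 + j.1 1) = 2 ∧ sig1 (FourPlanes.modeK m) + (j.1 2 + j.1 3) = 2 ∧ sig2 (FourPlanes.modeK m) + (j.1 4 + j.1 5) = 2) ∧ j.1 0 % 2 = FourPlanes.modeP0 m ∧ j.1 2 % 2 + FourPlanes.modeP2 m = 1 then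
    ζ ^ (5 * j.1 0 + 5 + (j.1 2 + 1) + (j.1 4 + 1)) * (if sig0 (FourPlanes.modeK m) = 2 then 1 else 1 + ζ ^ (2 * (FourPlanes.modeP0 m + j.1 0 + 1))) else 0

/-- STRUCTURE THEOREM (primitive ζ): M_[Z′] = U · V through K^11. -/
theorem ivhsMatrix_zprime_eq_mul {K : Type*} [Field K] (ζ : K) (h4 : ζ ^ 4 = -1) :
    ivhsMatrix 4 4 ζ [(1, plane44 3 0 0), (1, plane44 3 2 0), (1, plane44 2 0 0), (1, plane44 2 2 0)] = factorU ζ * factorV ζ := by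
  ext ⟨i, hi⟩ ⟨j, hj⟩
  rw [entry_eq_S ζ h4, Matrix.mul_apply]
  by_cases hex : ∃ m : Fin 11, (i 0 + i 1 = sig0 (FourPlanes.modeK m) ∧ i 2 + i 3 = sig1 (FourPlanes.modeK m) ∧ i 4 + i 5 = sig2 (FourPlanes.modeK m)) ∧
      i 0 % 2 = FourPlanes.modeP0 m ∧ i 2 % 2 = FourPlanes.modeP2 m
  · obtain ⟨m₀, ⟨h0, h1, h2⟩, p0, p2⟩ := hex
    obtain ⟨l0, l1, l2⟩ := sig_le4 (FourPlanes.modeK m₀)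
    rw [Finset.sum_eq_single m₀]
    · unfold factorU factorV
      simp only
      rw [if_pos (show (i 0 + i 1 = sig0 (FourPlanes.modeK m₀) ∧ i 2 + i 3 = sig1 (FourPlanes.modeK m₀) ∧ i 4 + i 5 = sig2 (FourPlanes.modeK m₀)) ∧
          i 0 % 2 = FourPlanes.modeP0 m₀ ∧ i 2 % 2 = FourPlanes.modeP2 m₀ from ⟨⟨h0, h1, h2⟩, p0, p2⟩)]
      by_cases hc : (sig0 (FourPlanes.modeK m₀) + (j 0 + j 1) = 2 ∧ sig1 (FourPlanes.modeK m₀) + (j 2 + j 3) = 2 ∧ sig2 (FourPlanes.modeK m₀) + (j 4 + j 5) = 2) ∧ j 0 % 2 = FourPlanes.modeP0 m₀ ∧ j 2 % 2 + FourPlanes.modeP2 m₀ = 1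
      · obtain ⟨⟨c0, c1, c2⟩, q0, q2⟩ := hc
        rw [if_pos (show (sig0 (FourPlanes.modeK m₀) + (j 0 + j 1) = 2 ∧ sig1 (FourPlanes.modeK m₀) + (j 2 + j 3) = 2 ∧ sig2 (FourPlanes.modeK m₀) + (j 4 + j 5) = 2) ∧ j 0 % 2 = FourPlanes.modeP0 m₀ ∧ j 2 % 2 + FourPlanes.modeP2 m₀ = 1 from
            ⟨⟨c0, c1, c2⟩, q0, q2⟩),
          if_pos (show (i 0 + j 0 + (i 1 + j 1) = 2 ∧ i 2 + j 2 + (i 3 + j 3) = 2 ∧ i 4 + j 4 + (i 5 + j 5) = 2) ∧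
            (i 0 + j 0) % 2 = 0 ∧ i 2 + j 2 = 1 from ⟨⟨by omega, by omega, by omega⟩, by omega, by omega⟩)]
        by_cases hσ : sig0 (FourPlanes.modeK m₀) = 2
        · rw [if_pos hσ, if_pos hσ]
          have hj0 : j 0 = 0 := by omega
          rw [hj0]
          ring
        · rw [if_neg hσ, if_neg hσ]
          have hi0 : FourPlanes.modeP0 m₀ = i 0 := by omega
          rw [hi0]
          ring
      · rw [if_neg hc, if_neg (fun h => hc ⟨⟨by omega, by omega, by omega⟩, by omega, by omega⟩)]
        simp
    · intro m _ hm
      unfold factorU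
      rw [if_neg, zero_mul]
      intro h
      exact hm (FourPlanes.mode_inj m m₀ (sig_inj _ _ (h.1.1.symm.trans h0) (h.1.2.1.symm.trans h1) (h.1.2.2.symm.trans h2)) (h.2.1.symm.trans p0) (h.2.2.symm.trans p2))
    · intro h
      exact absurd (Finset.mem_univ m₀) h
  · -- a row in no mode: all its entries vanish
    have hsum := row_deg i hi
    have hU : ∀ m, factorU ζ ⟨i, hi⟩ m = 0 := fun m => by
      unfold factorU
      exact if_neg (fun h => hex ⟨m, h⟩)
    rw [Finset.sum_eq_zero (fun m _ => by rw [hU m, zero_mul])]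
    rw [if_neg]
    rintro ⟨⟨c0, c1, c2⟩, s0, s2⟩
    obtain ⟨k, hk0, hk1, hk2⟩ := sig_cover4 (i 0 + i 1) (by omega) (i 2 + i 3) (by omega) (i 4 + i 5) (by omega) (by omega)
    obtain ⟨m, hm, hp0, hp2⟩ := mode_cover k (i 0 % 2) (by omega) (i 2 % 2) (by omega) (fun h => by omega) (fun h => by omega)
      (fun h => by omega)
    subst hm
    exact hex ⟨m, ⟨hk0, hk1, hk2⟩, hp0.symm, hp2.symm⟩

/-- UPPER BOUND: rank M_[Z′] ≤ 11 for a primitive 8th root. -/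
theorem rank_le {K : Type*} [Field K] (ζ : K) (h4 : ζ ^ 4 = -1) :
    (ivhsMatrix 4 4 ζ [(1, plane44 3 0 0), (1, plane44 3 2 0), (1, plane44 2 0 0), (1, plane44 2 2 0)]).rank ≤ 11 := by
  rw [ivhsMatrix_zprime_eq_mul ζ h4]
  exact (Matrix.rank_mul_le_left _ _).trans (by simpa using Matrix.rank_le_card_width (factorU ζ))

/-- the witness rows x^(p₀, σ₀−p₀, p₂, σ₁−p₂, σ₂, 0, …) lie in the row index set … -/
theorem r_mem (m : Fin 11) :
    (![FourPlanes.modeP0 m, sig0 (FourPlanes.modeK m) - FourPlanes.modeP0 m, FourPlanes.modeP2 m, sig1 (FourPlanes.modeK m) - FourPlanes.modeP2 m, sig2 (FourPlanes.modeK m), 0] : Fin 6 → ℕ) ∈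
      indexSet 4 4 (4 / 2 * 4 - 4 - 2) := by
  obtain ⟨l0, l1, l2⟩ := sig_le4 (FourPlanes.modeK m)
  have hs := sig_sum4 (FourPlanes.modeK m)
  obtain ⟨v0, v2, w0, w0', w2, w2'⟩ := mode_live m
  unfold indexSet
  simp only [Finset.mem_filter, Fintype.mem_piFinset, Finset.mem_range, Fin.forall_fin_succ, Fin.sum_univ_succ]
  simp
  omega

/-- … and the witness columns x^(p₀, 2−σ₀−p₀, 1−p₂, 1−σ₁+p₂, 2−σ₂, 0, …) in I₄. -/
theorem c_mem (m : Fin 11) :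
    (![FourPlanes.modeP0 m, 2 - sig0 (FourPlanes.modeK m) - FourPlanes.modeP0 m, 1 - FourPlanes.modeP2 m, 1 + FourPlanes.modeP2 m - sig1 (FourPlanes.modeK m), 2 - sig2 (FourPlanes.modeK m), 0] :
      Fin 6 → ℕ) ∈ indexSet 4 4 4 := by
  obtain ⟨l0, l1, l2⟩ := sig_le4 (FourPlanes.modeK m)
  have hs := sig_sum4 (FourPlanes.modeK m)
  obtain ⟨v0, v2, w0, w0', w2, w2'⟩ := mode_live m
  unfold indexSet
  simp only [Finset.mem_filter, Fintype.mem_piFinset, Finset.mem_range, Fin.forall_fin_succ, Fin.sum_univ_succ]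
  simp
  omega

/-- witness rows … -/
def r (m : Fin 11) : indexSet 4 4 (4 / 2 * 4 - 4 - 2) :=
  ⟨![FourPlanes.modeP0 m, sig0 (FourPlanes.modeK m) - FourPlanes.modeP0 m, FourPlanes.modeP2 m, sig1 (FourPlanes.modeK m) - FourPlanes.modeP2 m, sig2 (FourPlanes.modeK m), 0], r_mem m⟩

/-- … and witness columns. -/
def c (m : Fin 11) : indexSet 4 4 4 :=
  ⟨![FourPlanes.modeP0 m, 2 - sig0 (FourPlanes.modeK m) - FourPlanes.modeP0 m, 1 - FourPlanes.modeP2 m, 1 + FourPlanes.modeP2 m - sig1 (FourPlanes.modeK m), 2 - sig2 (FourPlanes.modeK m), 0],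
    c_mem m⟩

/-- pair sums of the witness rows = their type … -/
theorem r_sums : ∀ m : Fin 11, (r m).1 0 + (r m).1 1 = sig0 (FourPlanes.modeK m) ∧ (r m).1 2 + (r m).1 3 = sig1 (FourPlanes.modeK m) ∧ (r m).1 4 + (r m).1 5 = sig2 (FourPlanes.modeK m) := by
  decide

/-- … the witness columns have the complementary type … -/
theorem c_sums : ∀ m : Fin 11, sig0 (FourPlanes.modeK m) + ((c m).1 0 + (c m).1 1) = 2 ∧ sig1 (FourPlanes.modeK m) + ((c m).1 2 + (c m).1 3) = 2 ∧ sig2 (FourPlanes.modeK m) + ((c m).1 4 + (c m).1 5) = 2 := by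
  decide

/-- … on the diagonal the parity conditions hold … -/
theorem diag_par : ∀ m : Fin 11, ((r m).1 0 + (c m).1 0) % 2 = 0 ∧ (r m).1 2 + (c m).1 2 = 1 := by decide

/-- … and off the diagonal, within a type, one of them fails. -/
theorem offdiag_par : ∀ m m' : Fin 11, m ≠ m' → FourPlanes.modeK m = FourPlanes.modeK m' →
    ((r m).1 0 + (c m').1 0) % 2 = 1 ∨ (r m).1 2 + (c m').1 2 ≠ 1 := by decide

/-- the witness minor is DIAGONAL … -/
theorem minor_offdiag {K : Type*} [Field K] (ζ : K) (h4 : ζ ^ 4 = -1) (m m' : Fin 11) (hmm : m ≠ m') :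
    ivhsMatrix 4 4 ζ [(1, plane44 3 0 0), (1, plane44 3 2 0), (1, plane44 2 0 0), (1, plane44 2 2 0)] (r m) (c m') = 0 := by
  rw [entry_eq_S' ζ h4, if_neg]
  rintro ⟨⟨c0, c1, c2⟩, s0, s2⟩
  by_cases ht : FourPlanes.modeK m = FourPlanes.modeK m'
  · rcases offdiag_par m m' hmm ht with h | h
    · omega
    · exact h s2
  · obtain ⟨r0, r1, r2⟩ := r_sums m
    obtain ⟨q0, q1, q2⟩ := c_sums m'
    exact ht (sig_inj _ _ (by omega) (by omega) (by omega))

/-- … with diagonal entries 2(1 + ζ^{2A})ζ^e ≠ 0, A ∈ {1, 3} (characteristic 0; 1 + ζ² ≠ 0, 1 + ζ⁶ ≠ 0). -/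
theorem minor_diag {K : Type*} [Field K] [CharZero K] (ζ : K) (h4 : ζ ^ 4 = -1) (hz : ζ ≠ 0)
    (hA : 1 + ζ ^ (2 * (0 + 1)) ≠ 0) (hB : 1 + ζ ^ (2 * (2 + 1)) ≠ 0) (m : Fin 11) :
    ivhsMatrix 4 4 ζ [(1, plane44 3 0 0), (1, plane44 3 2 0), (1, plane44 2 0 0), (1, plane44 2 2 0)] (r m) (c m) ≠ 0 := by
  rw [entry_eq_S' ζ h4]
  obtain ⟨r0, r1, r2⟩ := r_sums m
  obtain ⟨q0, q1, q2⟩ := c_sums m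
  obtain ⟨d0, d2⟩ := diag_par m
  rw [if_pos ⟨⟨by omega, by omega, by omega⟩, d0, d2⟩]
  rcases (show (r m).1 0 + (c m).1 0 = 0 ∨ (r m).1 0 + (c m).1 0 = 2 by omega) with h | h
  · rw [h]
    exact mul_ne_zero (mul_ne_zero (by norm_num) hA) (pow_ne_zero _ hz)
  · rw [h]
    exact mul_ne_zero (mul_ne_zero (by norm_num) hB) (pow_ne_zero _ hz)

/-- LOWER BOUND: rank M_[Z′] ≥ 11. -/
theorem le_rank {K : Type*} [Field K] [CharZero K] (ζ : K) (h4 : ζ ^ 4 = -1) (hz : ζ ≠ 0)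
    (hA : 1 + ζ ^ (2 * (0 + 1)) ≠ 0) (hB : 1 + ζ ^ (2 * (2 + 1)) ≠ 0) :
    11 ≤ (ivhsMatrix 4 4 ζ [(1, plane44 3 0 0), (1, plane44 3 2 0), (1, plane44 2 0 0), (1, plane44 2 2 0)]).rank := by
  classical
  set M := ivhsMatrix 4 4 ζ [(1, plane44 3 0 0), (1, plane44 3 2 0), (1, plane44 2 0 0), (1, plane44 2 2 0)] with hM
  have hS : M.submatrix r c = Matrix.diagonal (fun a => M (r a) (c a)) := by
    ext a b
    by_cases hab : a = b
    · subst hab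
      rw [Matrix.diagonal_apply_eq, Matrix.submatrix_apply]
    · rw [Matrix.diagonal_apply_ne _ hab, Matrix.submatrix_apply]
      exact minor_offdiag ζ h4 a b hab
  have hdet : IsUnit (M.submatrix r c).det := by
    rw [hS, Matrix.det_diagonal]
    exact isUnit_iff_ne_zero.mpr (Finset.prod_ne_zero_iff.mpr fun a _ => minor_diag ζ h4 hz hA hB a)
  have hrank : (M.submatrix r c).rank = 11 := by
    rw [Matrix.rank_of_isUnit _ ((Matrix.isUnit_iff_isUnit_det _).mpr hdet), Fintype.card_fin]
  calc 11 = (M.submatrix r c).rank := hrank.symm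
    _ ≤ M.rank := Matrix.rank_submatrix_le M r c

/-- PROVED ROW: rank [p_{i+j}([Z′])] = 11 for the twisted four planes on the Fermat quartic 4-fold. -/
theorem ivhsRankEq_zprime : IvhsRankEq 4 4 11 [(1, plane44 3 0 0), (1, plane44 3 2 0), (1, plane44 2 0 0), (1, plane44 2 2 0)] := by
  intro K _ _ ζ hζ
  have h4 : ζ ^ 4 = -1 := zeta_pow_four_of_primitive hζ
  have h2 : ζ ^ 2 ≠ 1 := hζ.pow_ne_one_of_pos_of_lt (by norm_num) (by norm_num)
  have hA : 1 + ζ ^ (2 * (0 + 1)) ≠ 0 := by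
    intro h
    have h' : ζ ^ 4 = 1 := by linear_combination (ζ ^ 2 - 1) * h
    rw [h4] at h'
    norm_num at h'
  have hB : 1 + ζ ^ (2 * (2 + 1)) ≠ 0 := by
    intro h
    apply h2
    linear_combination (-1 : K) * h + ζ ^ 2 * h4
  exact le_antisymm (rank_le ζ h4) (le_rank ζ h4 (hζ.ne_zero (by norm_num)) hA hB)

/-- the census row `rankZprime_4_4` of `HodgeLocusCensusTwistCells` HOLDS. -/
theorem rankZprime_4_4_holds : rankZprime_4_4 := by
  unfold rankZprime_4_4 twistedFourPlanes4
  exact ivhsRankEq_zprime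

end Summit.HodgeConjecture.HodgeConjecture.HodgeLocus.Census.Zprime4
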